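import Literature.AnabelianGeometry.SemiGraphs.ArithLevelDataCpt
import Literature.AnabelianGeometry.SemiGraphs.TemperedClosedSubgroupCompact
import Literature.AnabelianGeometry.SemiGraphs.ArithStabilizerCompact
import Literature.AnabelianGeometry.SemiGraphs.ArithLevelDataCptOfCosetTower
import HarnessLib

/-!
# [SemiAnbd] Rmk 5.3.1 / Thm 5.4: verticial and edge-like subgroups of a compact-form arithmetic level
# package are CLOSED, and COMPACT modulo finite vertex stabilisers at the levels (`hVc` / `hBc`)

Mochizuki, *Semi-graphs of anabelioids*, Publ. RIMS **42** (2006) 221–322, §5: Rmk 5.3.1 p. 65 ("all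
verticial and edge-like subgroups of `Π^temp_𝔊` are compact"), the decomposition data of p. 65, Thm 5.4
(i)(ii) p. 66 with the proof of Thm 3.7 (iii) p. 41, kurims `paper:url-f33ace170ff4`.
[cite: MochizukiSemiAnbd2006, Rmk 5.3.1, p. 65]

PROOF-ONLY file (abc-iut cell, L3 sub-DAG `plan/L3/SUBDAG-SemiAnbd-Thm54.md`, producer row T54-B
sub-piece «hVc/hBc-inst», seat abc-iut-w4-d040 gen 3; capstone recipe of abc-iut-w4-d053
2026-08-26T05:42:55Z: "umbrella-Cpt (4) with `hVc`/`hBc` := `isCompact_of_fixes_vertices` ∘ the (AI1)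
dictionary").  No definition, no new named fact.  The LEVEL-B binders `hVc`/`hBc` of the Thm 5.4
(i)∧(ii) umbrella `arithMaximalCompactStatementI_and_II_ofChart_of_branchActionCptAt`
(ArithThm54OfBranchActionCpt.lean) as CLOSED theorems over ANY compact-form package
`Lc : ArithLevelDataCpt 𝔾 D aug baseAct` (abc-iut-w4-d053, ArithLevelDataCpt.lean):

* `ArithLevelDataCpt.isClosed_of_isVerticial` / `…_of_isEdgeLike` — by the two-sided fields (AI1) `fix`
  and (AI3) `edgeFix`, a verticial (edge-like) subgroup of `D` is the stabiliser of a compatible system of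
  tree vertices (of an eventual compatible system of tree edges with their branches); the tree actions
  have OPEN kernels (`isOpen_ker`), so these stabilisers are closed (`isClopen_preimage_of_isOpen_ker`).
* `ArithLevelDataCpt.isCompact_of_isVerticial` — in a TEMPERED `Π^temp_𝔊` (abc-iut-L3-d2) with a basis
  `(V i)` of open subgroups at `1` such that, for every `i`, at SOME level `j` every vertex stabiliser of
  the tree `T_j` has finite image in `Π^temp_𝔊 ⧸ V i` (the input `hfin`), every verticial subgroup is
  compact (`IsTempered.isCompact_of_isClosed_of_hasBasis`, abc-iut-w4-d053 p418285);
  `…_of_isEdgeLike` — an edge-like subgroup is closed and lies in a conjugate vertex group;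
  `isCompact_of_isVerticial_or_isEdgeLike` — the compactness half of Rmk 5.3.1, first sentence.
* For the PRODUCED data `decompositionDataOfChart R ι` (abc-iut-w4-d053 p412447): `hVc_of_hfin`,
  `hBc_of_hfin` — exactly the binders `hVc`/`hBc` of the umbrella.
* The input `hfin` DISCHARGED in the coset-tower currency of abc-iut-L3-d4 / abc-iut-w4-d053
  (`SemiGraph.SubgroupPresentation.finite_image_quotient_levelKer_inf_comap_of_fixes`,
  ArithStabilizerCompact.lean p422780, modulo the continuity binder `hK1′`):
  `finite_image_vertexStabilizer_quotient_levelKer_inf_comap` (every vertex of a coset semi-graph is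
  `H_w y K`; all `H_w` compact) and its basis-indexed form `hfin_of_cosetTower` — the shape consumed by
  `isCompact_of_isVerticial` at `Lc := ArithLevelDataCpt.ofCosetTower …` (p425422), whose trees ARE the
  coset semi-graphs `P.cosetGraph (K j)` with actions `P.arithAct hP (K j)`.
* `ProfiniteSemiGraph.hVc_hBc_of_cosetTower` — the literal instantiation at
  `ArithLevelDataCpt.ofCosetTower …` (abc-iut-w4-d053, ArithLevelDataCptOfCosetTower.lean; binders
  verbatim): `(∀ v, IsCompact (arithVertGp R ι v)) ∧ ∀ b, IsCompact (arithBrGp R ι b)`, the vertex groups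
  `H_w` being compact as §3 verticial subgroups (`isCompact_of_mem_verticialSubgroups`).

So, for the coset-tower package, `hVc`/`hBc` hold modulo exactly: `Π^temp_𝔊` tempered with basis
`levelKer (K n) ⊓ aug⁻¹ U` at `1`, `Π_A` compact, `ker aug ≤ range ι`, `hK1′`, the tree levels `K n` open
in `Π^temp_𝒢`, and the vertex groups `H_w` compact.  Nothing here takes a side on [IUTchIII] Cor. 3.12;
typed ≠ proved for the packages themselves.
-/

namespace Literature.AnabelianGeometry.SemiGraphs

open CategoryTheory Topology Filter
open scoped Pointwise

universe v u u' u'' w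

/-! ### Preimages under homomorphisms with open kernel are clopen -/

/-- A homomorphism with OPEN kernel has clopen fibres: the preimage of any set is a union of cosets of the
kernel. [folklore] -/
private theorem isClopen_preimage_of_isOpen_ker {G : Type*} [Group G] [TopologicalSpace G] [IsTopologicalGroup G]
    {A : Type*} [Group A] (f : G →* A) (hf : IsOpen (f.ker : Set G)) (Q : Set A) :
    IsClopen (f ⁻¹' Q) := by
  have hopen : ∀ Q : Set A, IsOpen (f ⁻¹' Q) := by
    intro Q
    rw [isOpen_iff_mem_nhds]
    intro g hg
    have h1 : (fun k => g * k) '' (f.ker : Set G) ⊆ f ⁻¹' Q := by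
      rintro _ ⟨k, hk, rfl⟩
      rw [Set.mem_preimage, map_mul, (MonoidHom.mem_ker).1 hk, mul_one]
      exact hg
    have h2 : (fun k => g * k) '' (f.ker : Set G) ∈ 𝓝 g :=
      ((Homeomorph.mulLeft g).isOpenMap _ hf).mem_nhds ⟨1, f.ker.one_mem, mul_one g⟩
    exact Filter.mem_of_superset h2 h1
  have hcl : IsClosed (f ⁻¹' Q) := by
    rw [← isOpen_compl_iff, ← Set.preimage_compl]
    exact hopen Qᶜ
  exact ⟨hcl, hopen Q⟩

namespace ArithLevelDataCpt

variable {Gtp : Type u'} [Group Gtp] [TopologicalSpace Gtp] [IsTopologicalGroup Gtp] {PA : Type u''}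
  [Group PA] {𝔾 : SemiGraph.{u}} {D : DecompositionData Gtp 𝔾.Vertex 𝔾.Branch} {aug : Gtp →* PA}
  {baseAct : PA →* Aut 𝔾} (Lc : ArithLevelDataCpt.{v} 𝔾 D aug baseAct)

include Lc

/-! ### Verticial and edge-like subgroups are closed -/

/-- **Verticial subgroups of a compact-form package are CLOSED** ([SemiAnbd] Thm 5.4 (i) via the proof of
Thm 3.7 (iii), p. 41): by (AI1) `fix` a verticial subgroup is the stabiliser of a compatible system of tree
vertices, and the tree actions have open kernels. [cite: MochizukiSemiAnbd2006, Rmk 5.3.1, p. 65] -/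
theorem isClosed_of_isVerticial (W : Subgroup Gtp) (hW : IsVerticial D W) : IsClosed (W : Set Gtp) := by
  obtain ⟨x, -, hWx⟩ := Lc.fix W hW
  have hset : (W : Set Gtp) = {g : Gtp | ∀ j, (Lc.act j g).hom.vertexMap (x j) = x j} := by
    ext g
    exact hWx g
  rw [hset]
  exact isClosed_setOf_forall_vertexMap_eq Lc.act Lc.isOpen_ker x

/-- **Edge-like subgroups of a compact-form package are CLOSED** ([SemiAnbd] Thm 5.4 (i), p. 41): by
(AI3) `edgeFix` an edge-like subgroup is the stabiliser of an eventual compatible system of tree edges with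
their branches, an intersection of clopen fibres of the tree actions.
[cite: MochizukiSemiAnbd2006, Rmk 5.3.1, p. 65] -/
theorem isClosed_of_isEdgeLike (W : Subgroup Gtp) (hW : IsEdgeLike D W) : IsClosed (W : Set Gtp) := by
  obtain ⟨i, ε, c, c', x₁, x₂, -, -, -, hWε⟩ := Lc.edgeFix W hW
  have hset : (W : Set Gtp) = ⋂ j : {j : Lc.J // i ≤ j},
      (Lc.act j.1) ⁻¹' {a : Aut (Lc.tree j.1) | a.hom.edgeMap (ε j) = ε j ∧
        ∀ b : (Lc.tree j.1).Branch, (Lc.tree j.1).edgeOf b = ε j → a.hom.branchMap b = b} := by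
    ext g
    simp only [SetLike.mem_coe, Set.mem_iInter, Set.mem_preimage, Set.mem_setOf_eq]
    exact hWε g
  rw [hset]
  exact isClosed_iInter fun j => (isClopen_preimage_of_isOpen_ker (Lc.act j.1) (Lc.isOpen_ker j.1) _).isClosed

/-! ### Compactness modulo finite vertex stabilisers at the levels -/

/-- **`hVc`, generic form: verticial subgroups of a compact-form package are COMPACT** ([SemiAnbd] Rmk 5.3.1
p. 65, "`Π^temp_{𝔊,v}` … compact", with p. 41): in a TEMPERED `Π^temp_𝔊` with a basis `(V i)` of open
subgroups at `1` such that for every `i` some tree level `j` has all its vertex stabilisers of finite image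
in `Π^temp_𝔊 ⧸ V i`, the (closed) stabiliser of a compatible vertex system is compact.
[cite: MochizukiSemiAnbd2006, Rmk 5.3.1, p. 65] -/
theorem isCompact_of_isVerticial (hE : IsTempered Gtp) {ι : Sort*} {p : ι → Prop} {V : ι → Subgroup Gtp}
    (hb : (𝓝 (1 : Gtp)).HasBasis p (fun i => (V i : Set Gtp)))
    (hfin : ∀ i, p i → ∃ j : Lc.J, ∀ x : (Lc.tree j).Vertex,
      ((QuotientGroup.mk : Gtp → Gtp ⧸ V i) '' {g : Gtp | (Lc.act j g).hom.vertexMap x = x}).Finite)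
    (W : Subgroup Gtp) (hW : IsVerticial D W) : IsCompact (W : Set Gtp) := by
  obtain ⟨x, -, hWx⟩ := Lc.fix W hW
  refine hE.isCompact_of_isClosed_of_hasBasis hb (Lc.isClosed_of_isVerticial W hW) fun i hi => ?_
  obtain ⟨j, hj⟩ := hfin i hi
  refine (hj (x j)).subset (Set.image_mono fun g hg => ?_)
  exact ((hWx g).1 hg) j

/-- **`hBc`, generic form: edge-like subgroups of a compact-form package are COMPACT** ([SemiAnbd] Rmk 5.3.1
p. 65, "`Π^temp_{𝔊,b} ⊆ Π^temp_{𝔊,v}`"): an edge-like subgroup is closed and lies in a conjugate of the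
vertex group of the vertex its branch abuts to (every branch abutting to a vertex: the frame of Thm 5.4,
graphs). [cite: MochizukiSemiAnbd2006, Rmk 5.3.1, p. 65] -/
theorem isCompact_of_isEdgeLike (hE : IsTempered Gtp) {ι : Sort*} {p : ι → Prop} {V : ι → Subgroup Gtp}
    (hb : (𝓝 (1 : Gtp)).HasBasis p (fun i => (V i : Set Gtp)))
    (hfin : ∀ i, p i → ∃ j : Lc.J, ∀ x : (Lc.tree j).Vertex,
      ((QuotientGroup.mk : Gtp → Gtp ⧸ V i) '' {g : Gtp | (Lc.act j g).hom.vertexMap x = x}).Finite)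
    (habut : ∀ b : 𝔾.Branch, (D.abut b).isSome)
    (W : Subgroup Gtp) (hW : IsEdgeLike D W) : IsCompact (W : Set Gtp) := by
  obtain ⟨b, g, rfl⟩ := hW
  obtain ⟨v, hv⟩ := Option.isSome_iff_exists.mp (habut b)
  have hle : conjSubgroup g (D.brGp b) ≤ conjSubgroup g (D.vertGp v) := by
    change (D.brGp b).map _ ≤ (D.vertGp v).map _
    exact Subgroup.map_mono (D.brGp_le_vertGp b v hv)
  exact (Lc.isCompact_of_isVerticial hE hb hfin _ ⟨v, g, rfl⟩).of_isClosed_subset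
    (Lc.isClosed_of_isEdgeLike _ ⟨b, g, rfl⟩) hle

/-- **Rmk 5.3.1, first sentence, COMPACTNESS half, for a compact-form package**: every verticial or
edge-like subgroup of `D` is compact (modulo the tempered basis and the finite vertex stabilisers `hfin`).
[cite: MochizukiSemiAnbd2006, Rmk 5.3.1, p. 65] -/
theorem isCompact_of_isVerticial_or_isEdgeLike (hE : IsTempered Gtp) {ι : Sort*} {p : ι → Prop}
    {V : ι → Subgroup Gtp} (hb : (𝓝 (1 : Gtp)).HasBasis p (fun i => (V i : Set Gtp)))
    (hfin : ∀ i, p i → ∃ j : Lc.J, ∀ x : (Lc.tree j).Vertex,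
      ((QuotientGroup.mk : Gtp → Gtp ⧸ V i) '' {g : Gtp | (Lc.act j g).hom.vertexMap x = x}).Finite)
    (habut : ∀ b : 𝔾.Branch, (D.abut b).isSome) (W : Subgroup Gtp)
    (hW : IsVerticial D W ∨ IsEdgeLike D W) : IsCompact (W : Set Gtp) :=
  hW.elim (Lc.isCompact_of_isVerticial hE hb hfin W) (Lc.isCompact_of_isEdgeLike hE hb hfin habut W)

end ArithLevelDataCpt

/-! ### `hVc` / `hBc` for the chart-produced decomposition data -/

namespace ProfiniteSemiGraph

variable {𝒢 : ProfiniteSemiGraph.{u}} {c : TemperedPiChart 𝒢}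
  {Gtp : Type u'} [Group Gtp] [TopologicalSpace Gtp] [IsTopologicalGroup Gtp]
  {PA : Type u''} [Group PA] {aug : Gtp →* PA} {baseAct : PA →* Aut 𝒢.graph}

omit [TopologicalSpace Gtp] [IsTopologicalGroup Gtp] in
/-- Conjugation by `1` is the identity on subgroups. [folklore] -/
private theorem conjSubgroup_one_eq (K : Subgroup Gtp) : conjSubgroup (1 : Gtp) K = K := by
  ext y
  constructor
  · rintro ⟨z, hz, rfl⟩
    simpa using hz
  · intro hy
    exact ⟨y, hy, by simp⟩

/-- **`hVc` of the Thm 5.4 (i)∧(ii) umbrella, for the PRODUCED data** ([SemiAnbd] p. 65: `Π^temp_{𝔊,v}`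
is compact): given ANY compact-form arithmetic level package for `decompositionDataOfChart R ι` over a
tempered `Π^temp_𝔊` whose tree levels have finite vertex stabilisers modulo a basis of open subgroups,
every `arithVertGp R ι v` is compact. [cite: MochizukiSemiAnbd2006, Rmk 5.3.1, p. 65] -/
theorem hVc_of_hfin (R : ChartRepresentatives c) (ι : c.G →* Gtp)
    (Lc : ArithLevelDataCpt.{v} 𝒢.graph (decompositionDataOfChart R ι) aug baseAct) (hE : IsTempered Gtp)
    {κ : Sort*} {p : κ → Prop} {V : κ → Subgroup Gtp}
    (hb : (𝓝 (1 : Gtp)).HasBasis p (fun i => (V i : Set Gtp)))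
    (hfin : ∀ i, p i → ∃ j : Lc.J, ∀ x : (Lc.tree j).Vertex,
      ((QuotientGroup.mk : Gtp → Gtp ⧸ V i) '' {g : Gtp | (Lc.act j g).hom.vertexMap x = x}).Finite)
    (v : 𝒢.graph.Vertex) : IsCompact (arithVertGp R ι v : Set Gtp) :=
  Lc.isCompact_of_isVerticial hE hb hfin (arithVertGp R ι v) ⟨v, 1, (conjSubgroup_one_eq _).symm⟩

/-- **`hBc` of the Thm 5.4 (i)∧(ii) umbrella, for the PRODUCED data** ([SemiAnbd] p. 65:
`Π^temp_{𝔊,b} ⊆ Π^temp_{𝔊,v}` compact), same inputs, for a GRAPH `𝔾` (every branch abuts to a vertex —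
the frame of Thm 5.4). [cite: MochizukiSemiAnbd2006, Rmk 5.3.1, p. 65] -/
theorem hBc_of_hfin (R : ChartRepresentatives c) (ι : c.G →* Gtp)
    (Lc : ArithLevelDataCpt.{v} 𝒢.graph (decompositionDataOfChart R ι) aug baseAct) (hE : IsTempered Gtp)
    {κ : Sort*} {p : κ → Prop} {V : κ → Subgroup Gtp}
    (hb : (𝓝 (1 : Gtp)).HasBasis p (fun i => (V i : Set Gtp)))
    (hfin : ∀ i, p i → ∃ j : Lc.J, ∀ x : (Lc.tree j).Vertex,
      ((QuotientGroup.mk : Gtp → Gtp ⧸ V i) '' {g : Gtp | (Lc.act j g).hom.vertexMap x = x}).Finite)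
    (hG : 𝒢.graph.IsGraph) (b : 𝒢.graph.Branch) : IsCompact (arithBrGp R ι b : Set Gtp) :=
  Lc.isCompact_of_isEdgeLike hE hb hfin (fun b' => hG.abuts_isSome b') (arithBrGp R ι b)
    ⟨b, 1, (conjSubgroup_one_eq _).symm⟩

end ProfiniteSemiGraph

/-! ### The finiteness input `hfin` in coset-tower currency (modulo `hK1′`) -/

namespace SemiGraph

namespace SubgroupPresentation

variable {𝔾 : SemiGraph.{u}} {Γ : Type u} [Group Γ] [TopologicalSpace Γ] [IsTopologicalGroup Γ]
  {E : Type v} [Group E]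
  (P : SubgroupPresentation 𝔾 Γ) {Φ : E →* MulAut Γ} {σ : E →* Aut 𝔾} (hP : P.IsArithCompatible Φ σ)
  {PA : Type w} [Group PA] [TopologicalSpace PA] [IsTopologicalGroup PA] [CompactSpace PA]
  (aug : E →* PA) (ι : Γ →* E) (hιΦ : ∀ g : Γ, Φ (ι g) = MulAut.conj g) (hισ : ∀ g : Γ, σ (ι g) = 1)

include hιΦ hισ

/-- **Finite vertex stabilisers at a coset-graph level, modulo a basic open subgroup** ([SemiAnbd] p. 65,
compactness of `Π^temp_{𝔊,v}`, in tower currency; abc-iut-w4-d053's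
`finite_image_quotient_levelKer_inf_comap_of_fixes` at the stabiliser itself): every vertex of the
level-`K` coset semi-graph is `H_w y K`, so for `K` open normal `Φ`-stable, ALL vertex groups `H_w` compact,
`ker aug ≤ range ι`, `Π_A` compact and `aug (levelKer K)` open (`hK1′`), the stabiliser of ANY vertex has
finite image in `E ⧸ (levelKer K ⊓ aug⁻¹ U)`. [cite: MochizukiSemiAnbd2006, Rmk 5.3.1, p. 65] -/
theorem finite_image_vertexStabilizer_quotient_levelKer_inf_comap (K : Subgroup Γ) [K.Normal]
    (hKst : ∀ (e : E) (x : Γ), x ∈ K → Φ e x ∈ K) (hKopen : IsOpen (K : Set Γ))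
    (hexact : aug.ker ≤ ι.range)
    (hK1' : IsOpen (((P.levelKer hP K hKst).map aug : Subgroup PA) : Set PA))
    (hHc : ∀ w : 𝔾.Vertex, IsCompact (P.H w : Set Γ)) (U : OpenNormalSubgroup PA)
    (x : (P.cosetGraph K).Vertex) :
    ((QuotientGroup.mk : E → E ⧸ (P.levelKer hP K hKst ⊓ U.toSubgroup.comap aug)) ''
      {e : E | (P.arithAct hP K hKst e).hom.vertexMap x = x}).Finite := by
  obtain ⟨w, y, rfl⟩ := P.vMk_surjective K x
  exact P.finite_image_quotient_levelKer_inf_comap_of_fixes hP K hKst aug ι hιΦ hισ hKopen hexact hK1' w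
    (hHc w) y _ (fun s hs => hs) U

/-- **The input `hfin` of `ArithLevelDataCpt.isCompact_of_isVerticial` AT THE COSET-GRAPH TOWER**, for
the basis `levelKer (K n) ⊓ aug⁻¹ U` (indexed by `ℕ × OpenNormalSubgroup Π_A`, abc-iut-L3-d2's tempered
topology): at index `(n, U)` take the tree level `n` itself.  At `Lc := ArithLevelDataCpt.ofCosetTower …`
(abc-iut-w4-d053 p425422: trees `P.cosetGraph (K n)`, actions `P.arithAct hP (K n)`) this is literally the
hypothesis `hfin`, so `hVc`/`hBc` hold there modulo the displayed binders (`hK1′`, compact `H_w`, open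
`K n`, `ker aug ≤ range ι`, `Π_A` compact). [cite: MochizukiSemiAnbd2006, Rmk 5.3.1, p. 65] -/
theorem hfin_of_cosetTower (K : ℕ → Subgroup Γ) [∀ n, (K n).Normal]
    (hKst : ∀ (n : ℕ) (e : E) (x : Γ), x ∈ K n → Φ e x ∈ K n) (hKopen : ∀ n, IsOpen (K n : Set Γ))
    (hexact : aug.ker ≤ ι.range)
    (hK1' : ∀ n, IsOpen (((P.levelKer hP (K n) (hKst n)).map aug : Subgroup PA) : Set PA))
    (hHc : ∀ w : 𝔾.Vertex, IsCompact (P.H w : Set Γ)) :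
    ∀ nU : ℕ × OpenNormalSubgroup PA, True → ∃ j : ℕ, ∀ x : (P.cosetGraph (K j)).Vertex,
      ((QuotientGroup.mk : E → E ⧸ (P.levelKer hP (K nU.1) (hKst nU.1) ⊓ nU.2.toSubgroup.comap aug)) ''
        {e : E | (P.arithAct hP (K j) (hKst j) e).hom.vertexMap x = x}).Finite :=
  fun nU _ => ⟨nU.1, fun x => P.finite_image_vertexStabilizer_quotient_levelKer_inf_comap hP aug ι hιΦ hισ
    (K nU.1) (hKst nU.1) (hKopen nU.1) hexact (hK1' nU.1) hHc nU.2 x⟩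

end SubgroupPresentation

end SemiGraph

/-! ### `hVc` / `hBc` AT THE COSET-GRAPH TOWER PACKAGE `ArithLevelDataCpt.ofCosetTower` -/

namespace ProfiniteSemiGraph

/-- **`hVc` ∧ `hBc` for the PRODUCED decomposition data over the coset-graph tower package** ([SemiAnbd]
Rmk 5.3.1 p. 65: "`Π^temp_{𝔊,v}`, `Π^temp_{𝔊,b}` … compact"): at `Lc := ArithLevelDataCpt.ofCosetTower …`
(abc-iut-w4-d053 p425422; binders verbatim) — whose trees ARE the coset semi-graphs `P.cosetGraph (K j)`
with the arithmetic actions `P.arithAct hP (K j)` — the input `hfin` of `hVc_of_hfin`/`hBc_of_hfin` IS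
`hfin_of_cosetTower` (definitional unfolding), the vertex groups `H_w` are compact as §3 verticial
subgroups (`isCompact_of_mem_verticialSubgroups`), and so EVERY `arithVertGp R ι v` and `arithBrGp R ι b`
is compact, modulo exactly: `Π^temp_𝔊 = E` tempered with basis `levelKer (K n) ⊓ aug⁻¹ U` at `1`
(abc-iut-L3-d2), `Π_A` compact, `ker aug ≤ range ι`, the continuity binder `hK1′`, and the tree levels
`K n` open in `Π^temp_𝒢`.  These are the binders `hVc`/`hBc` of
`arithMaximalCompactStatementI_and_II_ofChart_of_branchActionCptAt` at this `Lc`.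
[cite: MochizukiSemiAnbd2006, Rmk 5.3.1, p. 65] -/
theorem hVc_hBc_of_cosetTower {𝒢 : ProfiniteSemiGraph.{u}} (c : TemperedPiChart 𝒢)
    (h𝒢 : 𝒢.Thm37Hypotheses) (hG : 𝒢.graph.IsGraph) [Finite 𝒢.graph.Vertex] [Finite 𝒢.graph.Branch]
    (R : ChartRepresentatives c)
    {E : Type w} [Group E] [TopologicalSpace E] [IsTopologicalGroup E] {PA : Type v} [Group PA]
    [TopologicalSpace PA] [IsTopologicalGroup PA] [CompactSpace PA]
    (ι : c.G →* E) (hι : Function.Injective ι) (hnorm : (ι.range).Normal)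
    (aug : E →* PA) (baseAct : PA →* Aut 𝒢.graph)
    -- the subgroup presentation and its compatibility with the outer action (abc-iut-L3-d4)
    (P : SemiGraph.SubgroupPresentation 𝒢.graph c.G) {Φ : E →* MulAut c.G}
    (hP : P.IsArithCompatible Φ (baseAct.comp aug))
    (hιΦ : ∀ g : c.G, Φ (ι g) = MulAut.conj g) (hισ : ∀ g : c.G, (baseAct.comp aug) (ι g) = 1)
    (hPH : ∀ w, P.H w ∈ verticialSubgroups c w) (hPM : ∀ e, P.M e ∈ edgeLikeSubgroups c e)
    (w₀ : 𝒢.graph.Vertex)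
    -- the tree levels
    (K : ℕ → Subgroup c.G) [∀ j, (K j).Normal] (hK : ∀ ⦃i j : ℕ⦄, i ≤ j → K j ≤ K i)
    (hKst : ∀ (j : ℕ) (e : E) (x : c.G), x ∈ K j → Φ e x ∈ K j)
    (hT : ∀ j, (P.cosetGraph (K j)).IsTree)
    (hKopen : ∀ j, IsOpen ((P.arithAct hP (K j) (hKst j)).ker : Set E))
    -- Thm 5.4's printed frame hypothesis on the base
    (noSwitchBase : NoBranchSwitching 𝒢.graph.edgeOf
      (fun (a : PA) (b : 𝒢.graph.Branch) => (baseAct a).hom.branchMap b))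
    -- abc-iut-w4-d059's dict2 algebraic tower inputs (topological discharge: abc-iut-w4-d085 (P-K))
    (hHK : ∀ (w : 𝒢.graph.Vertex) (x : c.G), (∀ j, x ∈ (P.H w : Set c.G) * (K j : Set c.G)) → x ∈ P.H w)
    (hMK : ∀ (e : 𝒢.graph.Edge) (x : c.G), (∀ j, x ∈ (P.M e : Set c.G) * (K j : Set c.G)) → x ∈ P.M e)
    (hlift : ∀ (w : 𝒢.graph.Vertex) (y : ℕ → c.G),
      (∀ ⦃i j : ℕ⦄, i ≤ j →
        DoubleCoset.mk (P.H w) (K i) (y j) = DoubleCoset.mk (P.H w) (K i) (y i)) →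
      ∃ z : c.G, ∀ j, DoubleCoset.mk (P.H w) (K j) z = DoubleCoset.mk (P.H w) (K j) (y j))
    (hliftE : ∀ (j₁ : ℕ) (e : 𝒢.graph.Edge) (y : {j : ℕ // j₁ ≤ j} → c.G),
      (∀ ⦃i j : {j : ℕ // j₁ ≤ j}⦄, i.1 ≤ j.1 →
        DoubleCoset.mk (P.M e) (K i.1) (y j) = DoubleCoset.mk (P.M e) (K i.1) (y i)) →
      ∃ z : c.G, ∀ j, DoubleCoset.mk (P.M e) (K j.1) z = DoubleCoset.mk (P.M e) (K j.1) (y j))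
    -- the finite levels
    (L : ℕ → Subgroup c.G) [∀ j, (L j).Normal] [∀ j, Finite (c.G ⧸ L j)]
    (hL : ∀ ⦃i j : ℕ⦄, i ≤ j → L j ≤ L i)
    (hLst : ∀ (j : ℕ) (e : E) (x : c.G), x ∈ L j → Φ e x ∈ L j) (hKL : ∀ j, K j ≤ L j)
    (hfree : ∀ (j : ℕ) (w : 𝒢.graph.Vertex) (z x : c.G), x ∈ L j → z * x * z⁻¹ ∈ P.H w → x ∈ K j)
    -- the estrangement consequence at the finite levels (abc-iut-L3-t11's shape)
    (hnobpN : ∀ (C : Subgroup c.G) (j₀ : ℕ) (w : ∀ i : {i : ℕ // j₀ ≤ i}, (P.cosetGraph (L i.1)).Vertex)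
      (β β' : ∀ i : {i : ℕ // j₀ ≤ i}, (P.cosetGraph (L i.1)).Branch),
      (∀ i, β i ≠ β' i ∧ (P.cosetGraph (L i.1)).abuts (β i) = some (w i) ∧
        (P.cosetGraph (L i.1)).abuts (β' i) = some (w i)) →
      (∀ ⦃i i' : {i : ℕ // j₀ ≤ i}⦄ (h : i.1 ≤ i'.1), (P.cosetGraphTrans (hL h)).vertexMap (w i') = w i ∧
        (P.cosetGraphTrans (hL h)).branchMap (β i') = β i ∧
          (P.cosetGraphTrans (hL h)).branchMap (β' i') = β' i) →
      (∀ (i : {i : ℕ // j₀ ≤ i}) (γ : C), (P.arithAct hP (L i.1) (hLst i.1) (ι γ)).hom.vertexMap (w i) = w i ∧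
        (P.arithAct hP (L i.1) (hLst i.1) (ι γ)).hom.branchMap (β i) = β i ∧
          (P.arithAct hP (L i.1) (hLst i.1) (ι γ)).hom.branchMap (β' i) = β' i) → C = ⊥)
    -- (AI4″) at the finite levels (abc-iut-w4-d059, producer)
    (stabBranchPairAug : ∀ (C : Subgroup E), IsCompact (C : Set E) →
      ∀ (j₀ : ℕ) (w : ∀ i : {i : ℕ // j₀ ≤ i}, (P.cosetGraph (L i.1)).Vertex)
      (β β' : ∀ i : {i : ℕ // j₀ ≤ i}, (P.cosetGraph (L i.1)).Branch),
      (∀ i, β i ≠ β' i ∧ (P.cosetGraph (L i.1)).abuts (β i) = some (w i) ∧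
        (P.cosetGraph (L i.1)).abuts (β' i) = some (w i)) →
      (∀ ⦃i i' : {i : ℕ // j₀ ≤ i}⦄ (h : i.1 ≤ i'.1), (P.cosetGraphTrans (hL h)).vertexMap (w i') = w i ∧
        (P.cosetGraphTrans (hL h)).branchMap (β i') = β i ∧
          (P.cosetGraphTrans (hL h)).branchMap (β' i') = β' i) →
      (∀ (i : {i : ℕ // j₀ ≤ i}) (g : E), g ∈ C →
        (P.arithAct hP (L i.1) (hLst i.1) g).hom.vertexMap (w i) = w i ∧
        (P.arithAct hP (L i.1) (hLst i.1) g).hom.branchMap (β i) = β i ∧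
          (P.arithAct hP (L i.1) (hLst i.1) g).hom.branchMap (β' i) = β' i) →
      ∃ (v : 𝒢.graph.Vertex) (b b' : 𝒢.graph.Branch) (a : PA) (h : E),
        (decompositionDataOfChart R ι).abut b = some v ∧ (decompositionDataOfChart R ι).abut b' = some v ∧
        h ∈ (decompositionDataOfChart R ι).vertGp v ∧ (b' ≠ b ∨ h ∉ (decompositionDataOfChart R ι).brGp b) ∧
        C.map aug ≤ conjSubgroup a (((decompositionDataOfChart R ι).brGp b ⊓
          conjSubgroup h ((decompositionDataOfChart R ι).brGp b')).map aug))
    -- the LEVEL-B topology: tempered `E` with abc-iut-L3-d2's basis, exactness, `hK1′`, open tree levels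
    (hE : IsTempered E)
    (hb : (𝓝 (1 : E)).HasBasis (fun _ : ℕ × OpenNormalSubgroup PA => True)
      (fun nU => ((P.levelKer hP (K nU.1) (hKst nU.1) ⊓ nU.2.toSubgroup.comap aug : Subgroup E) :
        Set E)))
    (hexact : aug.ker ≤ ι.range)
    (hK1' : ∀ n, IsOpen (((P.levelKer hP (K n) (hKst n)).map aug : Subgroup PA) : Set PA))
    (hKopen' : ∀ n, IsOpen (K n : Set c.G)) :
    (∀ v, IsCompact (arithVertGp R ι v : Set E)) ∧ ∀ b, IsCompact (arithBrGp R ι b : Set E) := by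
  have hHc : ∀ w : 𝒢.graph.Vertex, IsCompact (P.H w : Set c.G) := fun w =>
    isCompact_of_mem_verticialSubgroups c (hPH w)
  have hfin := P.hfin_of_cosetTower hP aug ι hιΦ hισ K hKst hKopen' hexact hK1' hHc
  refine ⟨fun v => hVc_of_hfin R ι (ArithLevelDataCpt.ofCosetTower c h𝒢 hG R ι hι hnorm aug baseAct P hP
      hιΦ hισ hPH hPM w₀ K hK hKst hT hKopen noSwitchBase hHK hMK hlift hliftE L hL hLst hKL hfree hnobpN
      stabBranchPairAug) hE hb hfin v,
    fun b => hBc_of_hfin R ι (ArithLevelDataCpt.ofCosetTower c h𝒢 hG R ι hι hnorm aug baseAct P hP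
      hιΦ hισ hPH hPM w₀ K hK hKst hT hKopen noSwitchBase hHK hMK hlift hliftE L hL hLst hKL hfree hnobpN
      stabBranchPairAug) hE hb hfin hG b⟩

end ProfiniteSemiGraph

end Literature.AnabelianGeometry.SemiGraphs
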